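import Summits.FinalStateConjecture.FinalStateConjecture.Theorems.SwallowTheDatumKerrShieldedSettlesStubKerrVacuumAux5
import HarnessLib

/-!
# Kerr is Ricci-flat, algebra V: the flat quadratic Koszul terms, `k = 2, 3`

Support file for the stub `stub_kerrVacuum` of line `tapered-temporal-collar` (crux
`stmt-FinalStateConjecture-10054`): the Kerr metric `g_{M,a} = η + 2H ℓ ⊗ ℓ` in ingoing
Kerr–Schild Cartesian coordinates is Ricci-flat for all real `M, a, r₀` (`Kerr.isRicciFlat`).
The pure algebra is done over six real variables `(a, M, x₁, x₂, r, c)`: at a point of the chart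
with Kerr–Schild radius `r > 0` put `c = z/r` (`= cos θ`), so that the defining quartic of `r`
reads `x₂² = (r² + a²)(1 − c²) − x₁²`, and `Σ = r² + a²c²`, `H = M r/Σ`,
`ℓ = (1, (r x₁ + a x₂)/(r² + a²), (r x₂ − a x₁)/(r² + a²), c)`.
The closed-form tables `aaT2`, `aaT3`, `aaT`. Kerr–Schild 1965, §3.

## References

* R. P. Kerr, *Gravitational field of a spinning mass as an example of algebraically special
  metrics*, Phys. Rev. Lett. 11 (1963) 237–238.
* R. P. Kerr, A. Schild, *A new class of vacuum solutions of the Einstein field equations*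
  (1965), §§2–3.
* M. Visser, *The Kerr spacetime: a brief introduction*, arXiv:0706.0622, (32)–(36).
* B. O'Neill, *The geometry of Kerr black holes* (1995), Ch. 2, Thm. 2.6.1.
-/

set_option linter.dupNamespace false
set_option linter.unusedSimpArgs false
set_option linter.unusedTactic false
set_option linter.unreachableTactic false
set_option linter.unnecessarySeqFocus false

noncomputable section

namespace Summit.FinalStateConjecture.FinalStateConjecture.Theorems.SwallowTheDatum.KerrShieldedSettles

namespace StubKerrVacuum

/-- The flat quadratic Koszul terms `¼ η^{mm} ∑_i η^{ii} K(∂_i,∂_{l},∂_m) K(∂_2,∂_m,∂_i)`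
in closed form (`aaT2 l m`). [cite: KerrSchild1965, §3] -/
def aaT2 (a M x₁ x₂ r c : ℝ) : Fin 4 → Fin 4 → ℝ
  | 0, 0 => (-a*M*M*x₁) / ((r^2 + a^2*c^2)^3)
  | 0, 1 => (2*a*a*a*M*M*x₁*r^(6:ℕ)*c*c*c*c
      + 2*a*a*a*a*M*M*x₂*r^(5:ℕ)*c*c*c*c - 3*a^(5:ℕ)*M*M*x₁*r*r*r*r*c*c*c*c
      + 2*a^(6:ℕ)*M*M*x₂*r*r*r*c*c*c*c - 6*a^(7:ℕ)*M*M*x₁*r*r*c*c*c*c - a^(9:ℕ)*M*M*x₁*c*c*c*c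
      - 6*a*M*M*x₁*r^(8:ℕ)*c*c - 6*a*a*M*M*x₂*r^(7:ℕ)*c*c - 5*a*a*a*M*M*x₁*r^(6:ℕ)*c*c
      + 3*a*a*a*M*M*x₁*x₁*x₁*r*r*r*r*c*c - 12*a*a*a*a*M*M*x₂*r^(5:ℕ)*c*c
      + 8*a*a*a*a*M*M*x₁*x₁*x₂*r*r*r*c*c
      + 9*a^(5:ℕ)*M*M*x₁*r*r*r*r*c*c - 6*a^(5:ℕ)*M*M*x₁*x₁*x₁*r*r*c*c
      - 6*a^(6:ℕ)*M*M*x₂*r*r*r*c*c + 9*a^(7:ℕ)*M*M*x₁*r*r*c*c - a^(7:ℕ)*M*M*x₁*x₁*x₁*c*c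
      + a^(9:ℕ)*M*M*x₁*c*c + 4*M*M*x₁*x₁*x₂*r^(7:ℕ)
      + 6*a*M*M*x₁*r^(8:ℕ) - 9*a*M*M*x₁*x₁*x₁*r^(6:ℕ)
      + 2*a*a*M*M*x₂*r^(7:ℕ) - 4*a*a*M*M*x₁*x₁*x₂*r^(5:ℕ)
      + 7*a*a*a*M*M*x₁*r^(6:ℕ) - 2*a*a*a*M*M*x₁*x₁*x₁*r*r*r*r + 2*a*a*a*a*M*M*x₂*r^(5:ℕ)
      + 2*a^(5:ℕ)*M*M*x₁*r*r*r*r - a^(5:ℕ)*M*M*x₁*x₁*x₁*r*r + a^(7:ℕ)*M*M*x₁*r*r) / ((r^2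
      + a^2*c^2)^4 * (r^2 + a^2)^3)
  | 0, 2 => (-3*a*a*a*M*M*x₁*r^(6:ℕ)*c*c*c*c - 2*a*a*a*a*M*M*x₂*r^(5:ℕ)*c*c*c*c
      - 2*a^(6:ℕ)*M*M*x₂*r*r*r*c*c*c*c + 3*a^(7:ℕ)*M*M*x₁*r*r*c*c*c*c - 4*M*M*x₂*r^(9:ℕ)*c*c
      + 9*a*M*M*x₁*r^(8:ℕ)*c*c - 12*a*a*M*M*x₂*r^(7:ℕ)*c*c
      + 21*a*a*a*M*M*x₁*r^(6:ℕ)*c*c - 3*a*a*a*M*M*x₁*x₁*x₁*r*r*r*r*c*c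
      - 12*a*a*a*a*M*M*x₂*r^(5:ℕ)*c*c - 8*a*a*a*a*M*M*x₁*x₁*x₂*r*r*r*c*c
      + 15*a^(5:ℕ)*M*M*x₁*r*r*r*r*c*c
      + 6*a^(5:ℕ)*M*M*x₁*x₁*x₁*r*r*c*c - 4*a^(6:ℕ)*M*M*x₂*r*r*r*c*c + 3*a^(7:ℕ)*M*M*x₁*r*r*c*c
      + a^(7:ℕ)*M*M*x₁*x₁*x₁*c*c + 2*M*M*x₂*r^(9:ℕ) - 4*M*M*x₁*x₁*x₂*r^(7:ℕ) - 7*a*M*M*x₁*r^(8:ℕ)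
      + 9*a*M*M*x₁*x₁*x₁*r^(6:ℕ) + 2*a*a*M*M*x₂*r^(7:ℕ)
      + 4*a*a*M*M*x₁*x₁*x₂*r^(5:ℕ) - 8*a*a*a*M*M*x₁*r^(6:ℕ)
      + 2*a*a*a*M*M*x₁*x₁*x₁*r*r*r*r - a^(5:ℕ)*M*M*x₁*r*r*r*r + a^(5:ℕ)*M*M*x₁*x₁*x₁*r*r) / ((r^2
      + a^2*c^2)^4 * (r^2 + a^2)^3)
  | 0, 3 => (a*a*a*M*M*x₁*r*r*c*c*c*c + 2*a*a*a*a*M*M*x₂*r*c*c*c*c - a^(5:ℕ)*M*M*x₁*c*c*c*c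
      + 4*M*M*x₂*r^(5:ℕ)*c*c - 3*a*M*M*x₁*r*r*r*r*c*c - 2*a*a*M*M*x₂*r*r*r*c*c
      + 3*a*a*a*M*M*x₁*r*r*c*c) / ((r^2 + a^2*c^2)^4 * (r^2 + a^2))
  | 1, 0 => (2*a*a*a*M*M*r^(5:ℕ)*c*c*c*c + 2*a^(5:ℕ)*M*M*r*r*r*c*c*c*c - 6*a*M*M*r^(7:ℕ)*c*c
      + a*a*M*M*x₁*x₂*r*r*r*r*c*c - 12*a*a*a*M*M*r^(5:ℕ)*c*c
      + 4*a*a*a*a*M*M*x₁*x₂*r*r*c*c - 6*a^(5:ℕ)*M*M*r*r*r*c*c - 4*a^(5:ℕ)*M*M*x₁*x₁*r*c*c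
      - a^(6:ℕ)*M*M*x₁*x₂*c*c + M*M*x₁*x₂*r^(6:ℕ)
      + 2*a*M*M*r^(7:ℕ) - 4*a*M*M*x₁*x₁*r^(5:ℕ) - 4*a*a*M*M*x₁*x₂*r*r*r*r
      + 2*a*a*a*M*M*r^(5:ℕ) - a*a*a*a*M*M*x₁*x₂*r*r) / ((r^2 + a^2*c^2)^4 * (r^2 + a^2)^2)
  | 1, 1 => (2*a*a*a*M*M*x₁*x₁*r^(5:ℕ)*c*c*c*c
      + a*a*a*a*M*M*x₁*x₂*r*r*r*r*c*c*c*c - 2*a^(5:ℕ)*M*M*x₁*x₁*r*r*r*c*c*c*c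
      - 4*a^(7:ℕ)*M*M*x₁*x₁*r*c*c*c*c - a^(8:ℕ)*M*M*x₁*x₂*c*c*c*c - 2*a*M*M*x₁*x₁*r^(7:ℕ)*c*c
      + a*a*M*M*x₁*x₂*r^(6:ℕ)*c*c - a*a*M*M*x₁*x₁*x₁*x₂*r*r*r*r*c*c
      + 4*a*a*a*M*M*x₁*x₁*x₁*x₁*r*r*r*c*c + 3*a*a*a*a*M*M*x₁*x₂*r*r*r*r*c*c
      + 6*a*a*a*a*M*M*x₁*x₁*x₁*x₂*r*r*c*c
      + 6*a^(5:ℕ)*M*M*x₁*x₁*r*r*r*c*c - 4*a^(5:ℕ)*M*M*x₁*x₁*x₁*x₁*r*c*c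
      + 3*a^(6:ℕ)*M*M*x₁*x₂*r*r*c*c - a^(6:ℕ)*M*M*x₁*x₁*x₁*x₂*c*c + 4*a^(7:ℕ)*M*M*x₁*x₁*r*c*c
      + a^(8:ℕ)*M*M*x₁*x₂*c*c + 3*M*M*x₁*x₁*x₁*x₂*r^(6:ℕ)
      + 6*a*M*M*x₁*x₁*r^(7:ℕ) - 8*a*M*M*x₁*x₁*x₁*x₁*r^(5:ℕ)
      + 3*a*a*M*M*x₁*x₂*r^(6:ℕ) - 6*a*a*M*M*x₁*x₁*x₁*x₂*r*r*r*r + 6*a*a*a*M*M*x₁*x₁*r^(5:ℕ)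
      + 4*a*a*a*a*M*M*x₁*x₂*r*r*r*r - a*a*a*a*M*M*x₁*x₁*x₁*x₂*r*r
      + a^(6:ℕ)*M*M*x₁*x₂*r*r) / ((r^2 + a^2*c^2)^4 * (r^2 + a^2)^3)
  | 1, 2 => (-4*a*M*M*r^(9:ℕ)*c*c*c*c
      + a*a*M*M*x₁*x₂*r^(6:ℕ)*c*c*c*c - 4*a*a*a*M*M*r^(7:ℕ)*c*c*c*c
      - 4*a*a*a*M*M*x₁*x₁*r^(5:ℕ)*c*c*c*c
      + 4*a^(5:ℕ)*M*M*r^(5:ℕ)*c*c*c*c - 2*a^(5:ℕ)*M*M*x₁*x₁*r*r*r*c*c*c*c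
      - a^(6:ℕ)*M*M*x₁*x₂*r*r*c*c*c*c + 4*a^(7:ℕ)*M*M*r*r*r*c*c*c*c
      + 2*a^(7:ℕ)*M*M*x₁*x₁*r*c*c*c*c - 3*M*M*x₁*x₂*r^(8:ℕ)*c*c + 4*a*M*M*r^(9:ℕ)*c*c
      + 4*a*M*M*x₁*x₁*r^(7:ℕ)*c*c - 19*a*a*M*M*x₁*x₂*r^(6:ℕ)*c*c
      + a*a*M*M*x₁*x₁*x₁*x₂*r*r*r*r*c*c + 4*a*a*a*M*M*r^(7:ℕ)*c*c
      + 24*a*a*a*M*M*x₁*x₁*r^(5:ℕ)*c*c - 4*a*a*a*M*M*x₁*x₁*x₁*x₁*r*r*r*c*c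
      - 13*a*a*a*a*M*M*x₁*x₂*r*r*r*r*c*c - 6*a*a*a*a*M*M*x₁*x₁*x₁*x₂*r*r*c*c
      - 4*a^(5:ℕ)*M*M*r^(5:ℕ)*c*c + 20*a^(5:ℕ)*M*M*x₁*x₁*r*r*r*c*c
      + 4*a^(5:ℕ)*M*M*x₁*x₁*x₁*x₁*r*c*c + 3*a^(6:ℕ)*M*M*x₁*x₂*r*r*c*c
      + a^(6:ℕ)*M*M*x₁*x₁*x₁*x₂*c*c - 4*a^(7:ℕ)*M*M*r*r*r*c*c
      + M*M*x₁*x₂*r^(8:ℕ) - 3*M*M*x₁*x₁*x₁*x₂*r^(6:ℕ) - 6*a*M*M*x₁*x₁*r^(7:ℕ)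
      + 8*a*M*M*x₁*x₁*x₁*x₁*r^(5:ℕ)
      + 6*a*a*M*M*x₁*x₁*x₁*x₂*r*r*r*r - 6*a*a*a*M*M*x₁*x₁*r^(5:ℕ) - a*a*a*a*M*M*x₁*x₂*r*r*r*r
      + a*a*a*a*M*M*x₁*x₁*x₁*x₂*r*r) / ((r^2 + a^2*c^2)^4 * (r^2 + a^2)^3)
  | 1, 3 => (-2*a^(5:ℕ)*M*M*r*r*r*c^(6:ℕ) - 2*a^(7:ℕ)*M*M*r*c^(6:ℕ)
      + 4*a*M*M*r^(7:ℕ)*c*c*c*c - a*a*M*M*x₁*x₂*r*r*r*r*c*c*c*c + 10*a*a*a*M*M*r^(5:ℕ)*c*c*c*c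
      + 2*a*a*a*M*M*x₁*x₁*r*r*r*c*c*c*c + 2*a*a*a*a*M*M*x₁*x₂*r*r*c*c*c*c
      + 8*a^(5:ℕ)*M*M*r*r*r*c*c*c*c - 2*a^(5:ℕ)*M*M*x₁*x₁*r*c*c*c*c - a^(6:ℕ)*M*M*x₁*x₂*c*c*c*c
      + 2*a^(7:ℕ)*M*M*r*c*c*c*c + 3*M*M*x₁*x₂*r^(6:ℕ)*c*c - 2*a*M*M*x₁*x₁*r^(5:ℕ)*c*c
      + 2*a*a*M*M*x₁*x₂*r*r*r*r*c*c - 2*a*a*a*M*M*r^(5:ℕ)*c*c + 2*a*a*a*M*M*x₁*x₁*r*r*r*c*c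
      + 3*a*a*a*a*M*M*x₁*x₂*r*r*c*c - 2*a^(5:ℕ)*M*M*r*r*r*c*c) / ((r^2 + a^2*c^2)^4 * (r^2 + a^2)^2)
  | 2, 0 => (-a*a*M*M*r^(6:ℕ)*c*c*c*c - 4*a*a*a*a*M*M*r*r*r*r*c*c*c*c - 3*a^(6:ℕ)*M*M*r*r*c*c*c*c
      - M*M*r^(8:ℕ)*c*c + a*a*M*M*r^(6:ℕ)*c*c - a*a*M*M*x₁*x₁*r*r*r*r*c*c
      + 5*a*a*a*a*M*M*r*r*r*r*c*c - 4*a*a*a*a*M*M*x₁*x₁*r*r*c*c - 4*a^(5:ℕ)*M*M*x₁*x₂*r*c*c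
      + 3*a^(6:ℕ)*M*M*r*r*c*c + a^(6:ℕ)*M*M*x₁*x₁*c*c
      + M*M*r^(8:ℕ) - M*M*x₁*x₁*r^(6:ℕ) - 4*a*M*M*x₁*x₂*r^(5:ℕ)
      + 4*a*a*M*M*x₁*x₁*r*r*r*r - a*a*a*a*M*M*r*r*r*r + a*a*a*a*M*M*x₁*x₁*r*r) / ((r^2
      + a^2*c^2)^4 * (r^2 + a^2)^2)
  | 2, 1 => (-a*a*a*a*M*M*r^(6:ℕ)*c^(6:ℕ) - 2*a^(6:ℕ)*M*M*r*r*r*r*c^(6:ℕ)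
      - a^(8:ℕ)*M*M*r*r*c^(6:ℕ) + 7*a*a*M*M*r^(8:ℕ)*c*c*c*c + a*a*M*M*x₁*x₁*r^(6:ℕ)*c*c*c*c
      + 2*a*a*a*M*M*x₁*x₂*r^(5:ℕ)*c*c*c*c
      + 18*a*a*a*a*M*M*r^(6:ℕ)*c*c*c*c - 5*a*a*a*a*M*M*x₁*x₁*r*r*r*r*c*c*c*c
      + 15*a^(6:ℕ)*M*M*r*r*r*r*c*c*c*c - 5*a^(6:ℕ)*M*M*x₁*x₁*r*r*c*c*c*c
      - 2*a^(7:ℕ)*M*M*x₁*x₂*r*c*c*c*c + 4*a^(8:ℕ)*M*M*r*r*c*c*c*c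
      + a^(8:ℕ)*M*M*x₁*x₁*c*c*c*c - 3*M*M*x₁*x₁*r^(8:ℕ)*c*c - 6*a*M*M*x₁*x₂*r^(7:ℕ)*c*c
      - 8*a*a*M*M*r^(8:ℕ)*c*c + 10*a*a*M*M*x₁*x₁*r^(6:ℕ)*c*c + a*a*M*M*x₁*x₁*x₁*x₁*r*r*r*r*c*c
      + 4*a*a*a*M*M*x₁*x₁*x₁*x₂*r*r*r*c*c - 19*a*a*a*a*M*M*r^(6:ℕ)*c*c
      + 20*a*a*a*a*M*M*x₁*x₁*r*r*r*r*c*c - 6*a*a*a*a*M*M*x₁*x₁*x₁*x₁*r*r*c*c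
      + 10*a^(5:ℕ)*M*M*x₁*x₂*r*r*r*c*c - 4*a^(5:ℕ)*M*M*x₁*x₁*x₁*x₂*r*c*c
      - 14*a^(6:ℕ)*M*M*r*r*r*r*c*c + 6*a^(6:ℕ)*M*M*x₁*x₁*r*r*c*c + a^(6:ℕ)*M*M*x₁*x₁*x₁*x₁*c*c
      + 4*a^(7:ℕ)*M*M*x₁*x₂*r*c*c - 3*a^(8:ℕ)*M*M*r*r*c*c - a^(8:ℕ)*M*M*x₁*x₁*c*c
      + 3*M*M*x₁*x₁*r^(8:ℕ) - 3*M*M*x₁*x₁*x₁*x₁*r^(6:ℕ)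
      + 4*a*M*M*x₁*x₂*r^(7:ℕ) - 8*a*M*M*x₁*x₁*x₁*x₂*r^(5:ℕ)
      + a*a*M*M*r^(8:ℕ) - 3*a*a*M*M*x₁*x₁*r^(6:ℕ) + 6*a*a*M*M*x₁*x₁*x₁*x₁*r*r*r*r
      + 4*a*a*a*M*M*x₁*x₂*r^(5:ℕ) + 2*a*a*a*a*M*M*r^(6:ℕ) - 7*a*a*a*a*M*M*x₁*x₁*r*r*r*r
      + a*a*a*a*M*M*x₁*x₁*x₁*x₁*r*r + a^(6:ℕ)*M*M*r*r*r*r - a^(6:ℕ)*M*M*x₁*x₁*r*r) / ((r^2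
      + a^2*c^2)^4 * (r^2 + a^2)^3)
  | 2, 2 => (-a*a*M*M*r^(8:ℕ)*c^(6:ℕ) - 2*a*a*a*a*M*M*r^(6:ℕ)*c^(6:ℕ)
      - a^(6:ℕ)*M*M*r*r*r*r*c^(6:ℕ) + 3*M*M*r^(10:ℕ)*c*c*c*c
      + 14*a*a*M*M*r^(8:ℕ)*c*c*c*c - 2*a*a*M*M*x₁*x₁*r^(6:ℕ)*c*c*c*c
      - 4*a*a*a*M*M*x₁*x₂*r^(5:ℕ)*c*c*c*c + 19*a*a*a*a*M*M*r^(6:ℕ)*c*c*c*c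
      + 4*a*a*a*a*M*M*x₁*x₁*r*r*r*r*c*c*c*c - 4*a^(5:ℕ)*M*M*x₁*x₂*r*r*r*c*c*c*c
      + 8*a^(6:ℕ)*M*M*r*r*r*r*c*c*c*c + 6*a^(6:ℕ)*M*M*x₁*x₁*r*r*c*c*c*c - 4*M*M*r^(10:ℕ)*c*c
      + 6*M*M*x₁*x₁*r^(8:ℕ)*c*c + 8*a*M*M*x₁*x₂*r^(7:ℕ)*c*c - 15*a*a*M*M*r^(8:ℕ)*c*c
      + 8*a*a*M*M*x₁*x₁*r^(6:ℕ)*c*c - a*a*M*M*x₁*x₁*x₁*x₁*r*r*r*r*c*c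
      + 24*a*a*a*M*M*x₁*x₂*r^(5:ℕ)*c*c - 4*a*a*a*M*M*x₁*x₁*x₁*x₂*r*r*r*c*c
      - 18*a*a*a*a*M*M*r^(6:ℕ)*c*c - 10*a*a*a*a*M*M*x₁*x₁*r*r*r*r*c*c
      + 6*a*a*a*a*M*M*x₁*x₁*x₁*x₁*r*r*c*c + 16*a^(5:ℕ)*M*M*x₁*x₂*r*r*r*c*c
      + 4*a^(5:ℕ)*M*M*x₁*x₁*x₁*x₂*r*c*c - 7*a^(6:ℕ)*M*M*r*r*r*r*c*c
      - 12*a^(6:ℕ)*M*M*x₁*x₁*r*r*c*c - a^(6:ℕ)*M*M*x₁*x₁*x₁*x₁*c*c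
      + M*M*r^(10:ℕ) - 4*M*M*x₁*x₁*r^(8:ℕ) + 3*M*M*x₁*x₁*x₁*x₁*r^(6:ℕ) - 4*a*M*M*x₁*x₂*r^(7:ℕ)
      + 8*a*M*M*x₁*x₁*x₁*x₂*r^(5:ℕ)
      + 2*a*a*M*M*r^(8:ℕ) - 6*a*a*M*M*x₁*x₁*x₁*x₁*r*r*r*r - 4*a*a*a*M*M*x₁*x₂*r^(5:ℕ)
      + a*a*a*a*M*M*r^(6:ℕ) + 4*a*a*a*a*M*M*x₁*x₁*r*r*r*r - a*a*a*a*M*M*x₁*x₁*x₁*x₁*r*r) / ((r^2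
      + a^2*c^2)^4 * (r^2 + a^2)^3)
  | 2, 3 => (a*a*M*M*r^(6:ℕ)*c^(6:ℕ) - a^(6:ℕ)*M*M*r*r*c^(6:ℕ) - 3*M*M*r^(8:ℕ)*c*c*c*c
      - 5*a*a*M*M*r^(6:ℕ)*c*c*c*c + a*a*M*M*x₁*x₁*r*r*r*r*c*c*c*c
      + 2*a*a*a*M*M*x₁*x₂*r*r*r*c*c*c*c - a*a*a*a*M*M*r*r*r*r*c*c*c*c
      - 2*a*a*a*a*M*M*x₁*x₁*r*r*c*c*c*c - 2*a^(5:ℕ)*M*M*x₁*x₂*r*c*c*c*c + a^(6:ℕ)*M*M*r*r*c*c*c*c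
      + a^(6:ℕ)*M*M*x₁*x₁*c*c*c*c
      + 3*M*M*r^(8:ℕ)*c*c - 3*M*M*x₁*x₁*r^(6:ℕ)*c*c - 2*a*M*M*x₁*x₂*r^(5:ℕ)*c*c
      + 4*a*a*M*M*r^(6:ℕ)*c*c - 2*a*a*M*M*x₁*x₁*r*r*r*r*c*c + 2*a*a*a*M*M*x₁*x₂*r*r*r*c*c
      + a*a*a*a*M*M*r*r*r*r*c*c - 3*a*a*a*a*M*M*x₁*x₁*r*r*c*c) / ((r^2 + a^2*c^2)^4 * (r^2 + a^2)^2)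
  | 3, 0 => (a*a*M*M*x₂*r*c*c*c - 2*a*a*a*M*M*x₁*c*c*c + M*M*x₂*r*r*r*c
      + 2*a*M*M*x₁*r*r*c) / ((r^2 + a^2*c^2)^4)
  | 3, 1 => (2*a*a*a*M*M*x₁*r^(6:ℕ)*c^(5:ℕ) + a*a*a*a*M*M*x₂*r^(5:ℕ)*c^(5:ℕ)
      + 2*a^(5:ℕ)*M*M*x₁*r*r*r*r*c^(5:ℕ)
      + 2*a^(6:ℕ)*M*M*x₂*r*r*r*c^(5:ℕ) - 2*a^(7:ℕ)*M*M*x₁*r*r*c^(5:ℕ)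
      + a^(8:ℕ)*M*M*x₂*r*c^(5:ℕ) - 2*a^(9:ℕ)*M*M*x₁*c^(5:ℕ) - 6*a*M*M*x₁*r^(8:ℕ)*c*c*c
      - 7*a*a*M*M*x₂*r^(7:ℕ)*c*c*c - a*a*M*M*x₁*x₁*x₂*r^(5:ℕ)*c*c*c
      + 4*a*a*a*M*M*x₁*r^(6:ℕ)*c*c*c
      + 4*a*a*a*M*M*x₁*x₁*x₁*r*r*r*r*c*c*c - 11*a*a*a*a*M*M*x₂*r^(5:ℕ)*c*c*c
      + 4*a*a*a*a*M*M*x₁*x₁*x₂*r*r*r*c*c*c + 16*a^(5:ℕ)*M*M*x₁*r*r*r*r*c*c*c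
      + 2*a^(5:ℕ)*M*M*x₁*x₁*x₁*r*r*c*c*c - 5*a^(6:ℕ)*M*M*x₂*r*r*r*c*c*c
      + 5*a^(6:ℕ)*M*M*x₁*x₁*x₂*r*c*c*c
      + 8*a^(7:ℕ)*M*M*x₁*r*r*c*c*c - 2*a^(7:ℕ)*M*M*x₁*x₁*x₁*c*c*c - a^(8:ℕ)*M*M*x₂*r*c*c*c
      + 2*a^(9:ℕ)*M*M*x₁*c*c*c + 3*M*M*x₁*x₁*x₂*r^(7:ℕ)*c
      + 6*a*M*M*x₁*r^(8:ℕ)*c - 12*a*M*M*x₁*x₁*x₁*r^(6:ℕ)*c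
      + 3*a*a*M*M*x₂*r^(7:ℕ)*c - 16*a*a*M*M*x₁*x₁*x₂*r^(5:ℕ)*c - 2*a*a*a*M*M*x₁*r^(6:ℕ)*c
      + 6*a*a*a*M*M*x₁*x₁*x₁*r*r*r*r*c
      + 2*a*a*a*a*M*M*x₂*r^(5:ℕ)*c - 3*a*a*a*a*M*M*x₁*x₁*x₂*r*r*r*c - 10*a^(5:ℕ)*M*M*x₁*r*r*r*r*c
      + 2*a^(5:ℕ)*M*M*x₁*x₁*x₁*r*r*c - a^(6:ℕ)*M*M*x₂*r*r*r*c - 2*a^(7:ℕ)*M*M*x₁*r*r*c) / ((r^2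
      + a^2*c^2)^4 * (r^2 + a^2)^3)
  | 3, 2 => (a*a*M*M*x₂*r^(7:ℕ)*c^(5:ℕ) - 4*a*a*a*M*M*x₁*r^(6:ℕ)*c^(5:ℕ)
      + 2*a*a*a*a*M*M*x₂*r^(5:ℕ)*c^(5:ℕ) - 8*a^(5:ℕ)*M*M*x₁*r*r*r*r*c^(5:ℕ)
      + a^(6:ℕ)*M*M*x₂*r*r*r*c^(5:ℕ) - 4*a^(7:ℕ)*M*M*x₁*r*r*c^(5:ℕ) - 3*M*M*x₂*r^(9:ℕ)*c*c*c
      + 12*a*M*M*x₁*r^(8:ℕ)*c*c*c - 9*a*a*M*M*x₂*r^(7:ℕ)*c*c*c + a*a*M*M*x₁*x₁*x₂*r^(5:ℕ)*c*c*c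
      + 22*a*a*a*M*M*x₁*r^(6:ℕ)*c*c*c - 4*a*a*a*M*M*x₁*x₁*x₁*r*r*r*r*c*c*c
      - 13*a*a*a*a*M*M*x₂*r^(5:ℕ)*c*c*c - 4*a*a*a*a*M*M*x₁*x₁*x₂*r*r*r*c*c*c
      + 20*a^(5:ℕ)*M*M*x₁*r*r*r*r*c*c*c - 2*a^(5:ℕ)*M*M*x₁*x₁*x₁*r*r*c*c*c
      - 7*a^(6:ℕ)*M*M*x₂*r*r*r*c*c*c - 5*a^(6:ℕ)*M*M*x₁*x₁*x₂*r*c*c*c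
      + 10*a^(7:ℕ)*M*M*x₁*r*r*c*c*c + 2*a^(7:ℕ)*M*M*x₁*x₁*x₁*c*c*c
      + M*M*x₂*r^(9:ℕ)*c - 3*M*M*x₁*x₁*x₂*r^(7:ℕ)*c - 10*a*M*M*x₁*r^(8:ℕ)*c
      + 12*a*M*M*x₁*x₁*x₁*r^(6:ℕ)*c - 2*a*a*M*M*x₂*r^(7:ℕ)*c
      + 16*a*a*M*M*x₁*x₁*x₂*r^(5:ℕ)*c - 8*a*a*a*M*M*x₁*r^(6:ℕ)*c - 6*a*a*a*M*M*x₁*x₁*x₁*r*r*r*r*c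
      - 3*a*a*a*a*M*M*x₂*r^(5:ℕ)*c + 3*a*a*a*a*M*M*x₁*x₁*x₂*r*r*r*c
      + 2*a^(5:ℕ)*M*M*x₁*r*r*r*r*c - 2*a^(5:ℕ)*M*M*x₁*x₁*x₁*r*r*c) / ((r^2 + a^2*c^2)^4 * (r^2
      + a^2)^3)
  | 3, 3 => (-a*a*M*M*x₂*r*r*r*c^(5:ℕ) + 2*a*a*a*M*M*x₁*r*r*c^(5:ℕ) + a*a*a*a*M*M*x₂*r*c^(5:ℕ)
      + 3*M*M*x₂*r^(5:ℕ)*c*c*c - 6*a*M*M*x₁*r*r*r*r*c*c*c - 3*a*a*M*M*x₂*r*r*r*c*c*c) / ((r^2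
      + a^2*c^2)^4 * (r^2 + a^2))

/-- The flat quadratic Koszul terms `¼ η^{mm} ∑_i η^{ii} K(∂_i,∂_{l},∂_m) K(∂_3,∂_m,∂_i)`
in closed form (`aaT3 l m`). [cite: KerrSchild1965, §3] -/
def aaT3 (a M x₁ x₂ r c : ℝ) : Fin 4 → Fin 4 → ℝ
  | 0, 0 => 0
  | 0, 1 => (2*a*a*a*a*M*M*r*r*r*r*c^(5:ℕ)
      + 2*a^(6:ℕ)*M*M*r*r*c^(5:ℕ) - 6*a*a*M*M*r^(6:ℕ)*c*c*c - 2*a*a*a*M*M*x₁*x₂*r*r*r*c*c*c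
      - 12*a*a*a*a*M*M*r*r*r*r*c*c*c + 4*a*a*a*a*M*M*x₁*x₁*r*r*c*c*c
      + 2*a^(5:ℕ)*M*M*x₁*x₂*r*c*c*c - 6*a^(6:ℕ)*M*M*r*r*c*c*c + 4*M*M*x₁*x₁*r^(6:ℕ)*c
      + 6*a*M*M*x₁*x₂*r^(5:ℕ)*c + 2*a*a*M*M*r^(6:ℕ)*c + 2*a*a*a*M*M*x₁*x₂*r*r*r*c
      + 2*a*a*a*a*M*M*r*r*r*r*c) / ((r^2 + a^2*c^2)^4 * (r^2 + a^2)^2)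
  | 0, 2 => (-2*a*a*a*a*M*M*r*r*r*r*c^(5:ℕ) - 2*a^(6:ℕ)*M*M*r*r*c^(5:ℕ) - 4*M*M*r^(8:ℕ)*c*c*c
      - 10*a*a*M*M*r^(6:ℕ)*c*c*c
      + 2*a*a*a*M*M*x₁*x₂*r*r*r*c*c*c - 8*a*a*a*a*M*M*r*r*r*r*c*c*c
      - 4*a*a*a*a*M*M*x₁*x₁*r*r*c*c*c - 2*a^(5:ℕ)*M*M*x₁*x₂*r*c*c*c - 2*a^(6:ℕ)*M*M*r*r*c*c*c
      + 4*M*M*r^(8:ℕ)*c - 4*M*M*x₁*x₁*r^(6:ℕ)*c - 6*a*M*M*x₁*x₂*r^(5:ℕ)*c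
      + 6*a*a*M*M*r^(6:ℕ)*c - 2*a*a*a*M*M*x₁*x₂*r*r*r*c + 2*a*a*a*a*M*M*r*r*r*r*c) / ((r^2
      + a^2*c^2)^4 * (r^2 + a^2)^2)
  | 0, 3 => (2*a*a*a*a*M*M*c^(5:ℕ)
      + 4*M*M*r*r*r*r*c*c*c - 4*a*a*M*M*r*r*c*c*c - 2*M*M*r*r*r*r*c) / ((r^2 + a^2*c^2)^4)
  | 1, 0 => (a*a*M*M*x₁*r*r*r*c*c*c - 2*a*a*a*M*M*x₂*r*r*c*c*c + 3*a*a*a*a*M*M*x₁*r*c*c*c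
      + M*M*x₁*r^(5:ℕ)*c + 6*a*M*M*x₂*r*r*r*r*c - 5*a*a*M*M*x₁*r*r*r*c) / ((r^2
      + a^2*c^2)^4 * (r^2 + a^2))
  | 1, 1 => (a*a*a*a*M*M*x₁*r^(5:ℕ)*c^(5:ℕ) + 2*a^(6:ℕ)*M*M*x₁*r*r*r*c^(5:ℕ)
      + a^(8:ℕ)*M*M*x₁*r*c^(5:ℕ)
      + a*a*M*M*x₁*r^(7:ℕ)*c*c*c - a*a*M*M*x₁*x₁*x₁*r^(5:ℕ)*c*c*c
      - 2*a*a*a*M*M*x₁*x₁*x₂*r*r*r*r*c*c*c - 11*a*a*a*a*M*M*x₁*r^(5:ℕ)*c*c*c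
      - 4*a^(5:ℕ)*M*M*x₂*r*r*r*r*c*c*c - 2*a^(5:ℕ)*M*M*x₁*x₁*x₂*r*r*c*c*c
      - 13*a^(6:ℕ)*M*M*x₁*r*r*r*c*c*c
      + a^(6:ℕ)*M*M*x₁*x₁*x₁*r*c*c*c - 4*a^(7:ℕ)*M*M*x₂*r*r*c*c*c - a^(8:ℕ)*M*M*x₁*r*c*c*c
      + 3*M*M*x₁*x₁*x₁*r^(7:ℕ)*c + 2*a*M*M*x₁*x₁*x₂*r^(6:ℕ)*c - 5*a*a*M*M*x₁*r^(7:ℕ)*c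
      + 12*a*a*M*M*x₁*x₁*x₁*r^(5:ℕ)*c - 4*a*a*a*M*M*x₂*r^(6:ℕ)*c
      + 18*a*a*a*M*M*x₁*x₁*x₂*r*r*r*r*c
      + 2*a*a*a*a*M*M*x₁*r^(5:ℕ)*c - 7*a*a*a*a*M*M*x₁*x₁*x₁*r*r*r*c - 4*a^(5:ℕ)*M*M*x₂*r*r*r*r*c
      + 7*a^(6:ℕ)*M*M*x₁*r*r*r*c) / ((r^2 + a^2*c^2)^4 * (r^2 + a^2)^3)
  | 1, 2 => (a*a*M*M*x₁*r^(7:ℕ)*c^(5:ℕ) + 2*a*a*a*a*M*M*x₁*r^(5:ℕ)*c^(5:ℕ)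
      + a^(6:ℕ)*M*M*x₁*r*r*r*c^(5:ℕ) - 3*M*M*x₁*r^(9:ℕ)*c*c*c
      + 4*a*M*M*x₂*r^(8:ℕ)*c*c*c - 23*a*a*M*M*x₁*r^(7:ℕ)*c*c*c + a*a*M*M*x₁*x₁*x₁*r^(5:ℕ)*c*c*c
      + 2*a*a*a*M*M*x₂*r^(6:ℕ)*c*c*c
      + 2*a*a*a*M*M*x₁*x₁*x₂*r*r*r*r*c*c*c - 27*a*a*a*a*M*M*x₁*r^(5:ℕ)*c*c*c
      - 4*a^(5:ℕ)*M*M*x₂*r*r*r*r*c*c*c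
      + 2*a^(5:ℕ)*M*M*x₁*x₁*x₂*r*r*c*c*c - 9*a^(6:ℕ)*M*M*x₁*r*r*r*c*c*c
      - a^(6:ℕ)*M*M*x₁*x₁*x₁*r*c*c*c - 2*a^(7:ℕ)*M*M*x₂*r*r*c*c*c - 2*a^(8:ℕ)*M*M*x₁*r*c*c*c
      + 3*M*M*x₁*r^(9:ℕ)*c - 3*M*M*x₁*x₁*x₁*r^(7:ℕ)*c - 2*a*M*M*x₂*r^(8:ℕ)*c
      - 2*a*M*M*x₁*x₁*x₂*r^(6:ℕ)*c
      + 16*a*a*M*M*x₁*r^(7:ℕ)*c - 12*a*a*M*M*x₁*x₁*x₁*r^(5:ℕ)*c - 18*a*a*a*M*M*x₁*x₁*x₂*r*r*r*r*c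
      + 11*a*a*a*a*M*M*x₁*r^(5:ℕ)*c + 7*a*a*a*a*M*M*x₁*x₁*x₁*r*r*r*c
      + 2*a^(5:ℕ)*M*M*x₂*r*r*r*r*c - 2*a^(6:ℕ)*M*M*x₁*r*r*r*c) / ((r^2 + a^2*c^2)^4 * (r^2 + a^2)^3)
  | 1, 3 => (-a*a*M*M*x₁*r*r*r*c^(5:ℕ) + a*a*a*a*M*M*x₁*r*c^(5:ℕ) + 2*a^(5:ℕ)*M*M*x₂*c^(5:ℕ)
      + 3*M*M*x₁*r^(5:ℕ)*c*c*c - 4*a*M*M*x₂*r*r*r*r*c*c*c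
      + 3*a*a*M*M*x₁*r*r*r*c*c*c - 4*a*a*a*M*M*x₂*r*r*c*c*c - 2*M*M*x₁*r^(5:ℕ)*c
      - 2*a*M*M*x₂*r*r*r*r*c) / ((r^2 + a^2*c^2)^4 * (r^2 + a^2))
  | 2, 0 => (a*a*M*M*x₂*r*r*r*c*c*c + 2*a*a*a*M*M*x₁*r*r*c*c*c + 3*a*a*a*a*M*M*x₂*r*c*c*c
      + M*M*x₂*r^(5:ℕ)*c - 6*a*M*M*x₁*r*r*r*r*c - 5*a*a*M*M*x₂*r*r*r*c) / ((r^2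
      + a^2*c^2)^4 * (r^2 + a^2))
  | 2, 1 => (2*a*a*a*M*M*x₁*r^(6:ℕ)*c^(5:ℕ) + a*a*a*a*M*M*x₂*r^(5:ℕ)*c^(5:ℕ)
      + 4*a^(5:ℕ)*M*M*x₁*r*r*r*r*c^(5:ℕ) + 2*a^(6:ℕ)*M*M*x₂*r*r*r*c^(5:ℕ)
      + 2*a^(7:ℕ)*M*M*x₁*r*r*c^(5:ℕ)
      + a^(8:ℕ)*M*M*x₂*r*c^(5:ℕ) - 6*a*M*M*x₁*r^(8:ℕ)*c*c*c - 7*a*a*M*M*x₂*r^(7:ℕ)*c*c*c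
      - a*a*M*M*x₁*x₁*x₂*r^(5:ℕ)*c*c*c - 24*a*a*a*M*M*x₁*r^(6:ℕ)*c*c*c
      + 2*a*a*a*M*M*x₁*x₁*x₁*r*r*r*r*c*c*c - 21*a*a*a*a*M*M*x₂*r^(5:ℕ)*c*c*c
      - 18*a^(5:ℕ)*M*M*x₁*r*r*r*r*c*c*c
      + 2*a^(5:ℕ)*M*M*x₁*x₁*x₁*r*r*c*c*c - 17*a^(6:ℕ)*M*M*x₂*r*r*r*c*c*c
      + a^(6:ℕ)*M*M*x₁*x₁*x₂*r*c*c*c - 3*a^(8:ℕ)*M*M*x₂*r*c*c*c + 3*M*M*x₁*x₁*x₂*r^(7:ℕ)*c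
      + 4*a*M*M*x₁*r^(8:ℕ)*c - 2*a*M*M*x₁*x₁*x₁*r^(6:ℕ)*c + a*a*M*M*x₂*r^(7:ℕ)*c
      + 12*a*a*M*M*x₁*x₁*x₂*r^(5:ℕ)*c
      + 20*a*a*a*M*M*x₁*r^(6:ℕ)*c - 18*a*a*a*M*M*x₁*x₁*x₁*r*r*r*r*c
      + 6*a*a*a*a*M*M*x₂*r^(5:ℕ)*c - 7*a*a*a*a*M*M*x₁*x₁*x₂*r*r*r*c + 16*a^(5:ℕ)*M*M*x₁*r*r*r*r*c
      + 5*a^(6:ℕ)*M*M*x₂*r*r*r*c) / ((r^2 + a^2*c^2)^4 * (r^2 + a^2)^3)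
  | 2, 2 => (a*a*M*M*x₂*r^(7:ℕ)*c^(5:ℕ) - 2*a*a*a*M*M*x₁*r^(6:ℕ)*c^(5:ℕ)
      + 2*a*a*a*a*M*M*x₂*r^(5:ℕ)*c^(5:ℕ) - 4*a^(5:ℕ)*M*M*x₁*r*r*r*r*c^(5:ℕ)
      + a^(6:ℕ)*M*M*x₂*r*r*r*c^(5:ℕ) - 2*a^(7:ℕ)*M*M*x₁*r*r*c^(5:ℕ) - 3*M*M*x₂*r^(9:ℕ)*c*c*c
      + 2*a*M*M*x₁*r^(8:ℕ)*c*c*c - 15*a*a*M*M*x₂*r^(7:ℕ)*c*c*c + a*a*M*M*x₁*x₁*x₂*r^(5:ℕ)*c*c*c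
      + 22*a*a*a*M*M*x₁*r^(6:ℕ)*c*c*c - 2*a*a*a*M*M*x₁*x₁*x₁*r*r*r*r*c*c*c
      - 17*a*a*a*a*M*M*x₂*r^(5:ℕ)*c*c*c
      + 26*a^(5:ℕ)*M*M*x₁*r*r*r*r*c*c*c - 2*a^(5:ℕ)*M*M*x₁*x₁*x₁*r*r*c*c*c
      - 5*a^(6:ℕ)*M*M*x₂*r*r*r*c*c*c - a^(6:ℕ)*M*M*x₁*x₁*x₂*r*c*c*c + 6*a^(7:ℕ)*M*M*x₁*r*r*c*c*c
      + 3*M*M*x₂*r^(9:ℕ)*c - 3*M*M*x₁*x₁*x₂*r^(7:ℕ)*c - 2*a*M*M*x₁*r^(8:ℕ)*c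
      + 2*a*M*M*x₁*x₁*x₁*r^(6:ℕ)*c
      + 10*a*a*M*M*x₂*r^(7:ℕ)*c - 12*a*a*M*M*x₁*x₁*x₂*r^(5:ℕ)*c - 16*a*a*a*M*M*x₁*r^(6:ℕ)*c
      + 18*a*a*a*M*M*x₁*x₁*x₁*r*r*r*r*c + 7*a*a*a*a*M*M*x₂*r^(5:ℕ)*c
      + 7*a*a*a*a*M*M*x₁*x₁*x₂*r*r*r*c - 14*a^(5:ℕ)*M*M*x₁*r*r*r*r*c) / ((r^2 + a^2*c^2)^4 * (r^2
      + a^2)^3)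
  | 2, 3 => (-a*a*M*M*x₂*r*r*r*c^(5:ℕ) + a*a*a*a*M*M*x₂*r*c^(5:ℕ) - 2*a^(5:ℕ)*M*M*x₁*c^(5:ℕ)
      + 3*M*M*x₂*r^(5:ℕ)*c*c*c + 4*a*M*M*x₁*r*r*r*r*c*c*c + 3*a*a*M*M*x₂*r*r*r*c*c*c
      + 4*a*a*a*M*M*x₁*r*r*c*c*c - 2*M*M*x₂*r^(5:ℕ)*c + 2*a*M*M*x₁*r*r*r*r*c) / ((r^2
      + a^2*c^2)^4 * (r^2 + a^2))
  | 3, 0 => (a*a*M*M*r*r*c*c*c*c + a*a*a*a*M*M*c*c*c*c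
      + M*M*r*r*r*r*c*c - 3*a*a*M*M*r*r*c*c) / ((r^2 + a^2*c^2)^4)
  | 3, 1 => (a*a*a*a*M*M*r*r*c^(6:ℕ)
      + a^(6:ℕ)*M*M*c^(6:ℕ) - 7*a*a*M*M*r*r*r*r*c*c*c*c - a*a*M*M*x₁*x₁*r*r*c*c*c*c
      - 2*a*a*a*M*M*x₁*x₂*r*c*c*c*c - 8*a*a*a*a*M*M*r*r*c*c*c*c
      + a*a*a*a*M*M*x₁*x₁*c*c*c*c - a^(6:ℕ)*M*M*c*c*c*c + 3*M*M*x₁*x₁*r*r*r*r*c*c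
      + 6*a*M*M*x₁*x₂*r*r*r*c*c + 3*a*a*M*M*r*r*r*r*c*c - 3*a*a*M*M*x₁*x₁*r*r*c*c
      + 3*a*a*a*a*M*M*r*r*c*c) / ((r^2 + a^2*c^2)^4 * (r^2 + a^2))
  | 3, 2 => (a*a*M*M*r*r*r*r*c^(6:ℕ)
      + a*a*a*a*M*M*r*r*c^(6:ℕ) - 3*M*M*r^(6:ℕ)*c*c*c*c - 8*a*a*M*M*r*r*r*r*c*c*c*c
      + a*a*M*M*x₁*x₁*r*r*c*c*c*c
      + 2*a*a*a*M*M*x₁*x₂*r*c*c*c*c - 5*a*a*a*a*M*M*r*r*c*c*c*c - a*a*a*a*M*M*x₁*x₁*c*c*c*c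
      + 3*M*M*r^(6:ℕ)*c*c - 3*M*M*x₁*x₁*r*r*r*r*c*c - 6*a*M*M*x₁*x₂*r*r*r*c*c
      + 3*a*a*M*M*r*r*r*r*c*c + 3*a*a*M*M*x₁*x₁*r*r*c*c) / ((r^2 + a^2*c^2)^4 * (r^2 + a^2))
  | 3, 3 => (-a*a*M*M*r*r*c^(6:ℕ) + a*a*a*a*M*M*c^(6:ℕ)
      + 3*M*M*r*r*r*r*c*c*c*c - a*a*M*M*r*r*c*c*c*c - 2*M*M*r*r*r*r*c*c) / ((r^2 + a^2*c^2)^4)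

/-- The flat quadratic Koszul terms `aaT k l m = ¼ η^{mm} ∑_i η^{ii} K(∂_i,∂_l,∂_m) K(∂_k,∂_m,∂_i)`
in closed form. [cite: KerrSchild1965, §3] -/
def aaT (a M x₁ x₂ r c : ℝ) : Fin 4 → Fin 4 → Fin 4 → ℝ
  | 0, l, m => aaT0 a M x₁ x₂ r c l m
  | 1, l, m => aaT1 a M x₁ x₂ r c l m
  | 2, l, m => aaT2 a M x₁ x₂ r c l m
  | 3, l, m => aaT3 a M x₁ x₂ r c l m

end StubKerrVacuum

/-- **Registered sub-goal `stub_kerrVacuumTable_aaT2`** of stub `stub_kerrVacuum` (line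
`tapered-temporal-collar`): the entry `(1,1)` of the closed-form table `aaT2` of this file.
[cite: KerrSchild1965, §3] -/
theorem stub_kerrVacuumTable_aaT2 : ∀ (a M x₁ x₂ r c : ℝ),
    StubKerrVacuum.aaT2 a M x₁ x₂ r c 1 1 = (2*a*a*a*M*M*x₁*x₁*r^(5:ℕ)*c*c*c*c
    + a*a*a*a*M*M*x₁*x₂*r*r*r*r*c*c*c*c - 2*a^(5:ℕ)*M*M*x₁*x₁*r*r*r*c*c*c*c
    - 4*a^(7:ℕ)*M*M*x₁*x₁*r*c*c*c*c - a^(8:ℕ)*M*M*x₁*x₂*c*c*c*c - 2*a*M*M*x₁*x₁*r^(7:ℕ)*c*c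
    + a*a*M*M*x₁*x₂*r^(6:ℕ)*c*c - a*a*M*M*x₁*x₁*x₁*x₂*r*r*r*r*c*c
    + 4*a*a*a*M*M*x₁*x₁*x₁*x₁*r*r*r*c*c + 3*a*a*a*a*M*M*x₁*x₂*r*r*r*r*c*c
    + 6*a*a*a*a*M*M*x₁*x₁*x₁*x₂*r*r*c*c
    + 6*a^(5:ℕ)*M*M*x₁*x₁*r*r*r*c*c - 4*a^(5:ℕ)*M*M*x₁*x₁*x₁*x₁*r*c*c
    + 3*a^(6:ℕ)*M*M*x₁*x₂*r*r*c*c - a^(6:ℕ)*M*M*x₁*x₁*x₁*x₂*c*c + 4*a^(7:ℕ)*M*M*x₁*x₁*r*c*c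
    + a^(8:ℕ)*M*M*x₁*x₂*c*c + 3*M*M*x₁*x₁*x₁*x₂*r^(6:ℕ)
    + 6*a*M*M*x₁*x₁*r^(7:ℕ) - 8*a*M*M*x₁*x₁*x₁*x₁*r^(5:ℕ)
    + 3*a*a*M*M*x₁*x₂*r^(6:ℕ) - 6*a*a*M*M*x₁*x₁*x₁*x₂*r*r*r*r + 6*a*a*a*M*M*x₁*x₁*r^(5:ℕ)
    + 4*a*a*a*a*M*M*x₁*x₂*r*r*r*r - a*a*a*a*M*M*x₁*x₁*x₁*x₂*r*r + a^(6:ℕ)*M*M*x₁*x₂*r*r) / ((r^2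
    + a^2*c^2)^4 * (r^2 + a^2)^3) :=
  fun _ _ _ _ _ _ ↦ rfl

end Summit.FinalStateConjecture.FinalStateConjecture.Theorems.SwallowTheDatum.KerrShieldedSettles
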